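import Literature.NumberTheory.LFunctions.Zhang2022.KnifeEdgeLenSiegelSlots

/-!
# Zhang (2022), rung F-S3 (Landau–Siegel programme, §D edge len = E*-len⁺): card `siegel-model-family-index`
# (ls-knife-len-idea-2) — the ONE-SIDED rung of record after the critic's ruling: the Siegel MAJORANT of the family
# index (PROVED, unconditional), the UPPER shape `EStarLenPlusUpperShape` and its positivity endgame (PROVED), and
# the one-sided transfer «Siegel-family asymptotic ∧ nonneg weights ⇒ Theorem 1-endgame» needing NO transfer identity

Y. Zhang, *Discrete mean estimates and the Landau–Siegel zero*, arXiv:2211.02515v1 [Zhang2022LandauSiegel] —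
an unrefereed manuscript under adjudication; T. Tao, J. Teräväinen [TaoTeravainen2021] (the Siegel model
`Λ_Siegel = (χ ∗ log)·ν_R`). **WHAT THIS IS NOT: not a claim about Theorems 1–2 of arXiv:2211.02515, about
Landau–Siegel zeros, or about Parity. The programme SEARCHES and TYPES; no claim about Landau–Siegel zeros,
Theorems 1–2 of arXiv:2211.02515 or a repaired Margin232 until a kernel theorem says so. `EStarLenPlusUpperShape`,
`SiegelEStarLenPlusShape`, `SiegelWeightsNonneg` are bare `Prop`s (statement SHAPES, asserted by no one); every
`theorem` is unconditional finite bookkeeping (the majorant) or an implication between named `Prop`s and the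
skeleton's CLAIMS `Prop22i`, `Lemma23`.**

THE CRITIC'S RULING (ls-knife-crit-1, 2026-08-26T22:31:36Z, on referee ls-ref-1's currency objection): the two-sided
transfer K1 `SiegelModuliTransfer c` is struck as a rung (sup/avg currency beyond the wall, F-len-10b; its transfer
calculus stays typed in `KnifeEdgeLenSiegelTransfer`/`…Slots` with the sup hypothesis named), but the line SURVIVES
ONE-SIDED: «the positivity endgame consumes only `discMean ≤ (main + ε)𝔞𝔓`, and `Σ_{p∈W} log p·G(p) ≤ Σ_{m∈W}
Λ_S(m)G(m)` (`G ≥ 0`) is unconditional and exact». This file types and proves exactly that: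

* Part 1 (PROVED, no (A), no error term). `SiegelModuliDominate` — the critic's rung of record «`∀ G ≥ 0,
  Σ_{p ∈ primeWindow} log p·G(p) ≤ Σ_{m ∈ moduliWindow} Λ_Siegel(m)·G(m)`» as a `Prop` in K1's quantifier shape,
  and `SiegelModuliDominate_holds` (primes of the window are moduli of the window; `Λ_Siegel ≥ 0` for quadratic `χ`,
  `siegelModulusWeight_nonneg`; `Λ_Siegel(p) = log p` on primes `p ≥ R`, `vonMangoldtSiegel_prime`; eventually
  `1 < R = exp 𝓛⁸ ≤ P`); density form `sum_primeWindow_le_sum_density` and `frakP_le_frakPS` (`𝔓 ≤ 𝔓_S`).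
* Part 2 (PROVED). Domination of discrete MEANS: if the weights `Re 𝔠*·Re ω` are `≥ 0` on the Siegel family's
  `Ψ₁ × zeros` (bare Prop `SiegelWeightsNonneg c'` = Lemma 2.3 ∧ Prop 2.2 (i) read at EVERY modulus of the window —
  the manuscript states them for prime moduli only), then for every table `U`,
  `discMean (U∘toS) ≤ discMeanS U` (`discMean_le_discMeanS`) — exact, no sup/avg hypothesis, no K1.
* Part 3 (PROVED). The checked fact behind the ruling: the endgame `eventually_not_assumptionA_of_negative_mainTerm`
  uses only the UPPER half. `eventually_not_assumptionA_of_upper_mainTerm` — for ANY tables and ANY eventually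
  positive normaliser `N`, an upper asymptotic `discMean ≤ (m + ε)·𝔞·N` with `m < 0` refutes (A) eventually (given
  `Prop22i`, `Lemma23`, `frakALowerBound_holds`); `EStarLenPlusUpperShape c' θ X 𝒱` (E-002's row with `|·|` dropped,
  `≤` kept), `EStarLenPlusShape.upper`, and `theorem1_of_eStarLenPlusUpperShape` (same conclusion as
  `theorem1_of_eStarLenPlusShape`).
* Part 4 (PROVED implication; hypotheses OPEN). The ONE-SIDED TRANSFER: `SiegelEStarLenPlusShape c' ψc θ X 𝒱` (the
  Siegel family's two-sided whole-design asymptotic, normaliser `𝔓_S` — the object the card's K2 «CIS divisor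
  switching for the linearised family» is to evaluate) ∧ `SiegelWeightsNonneg c'` ∧ `ClosesByPositivityIn θ X 𝒱` ∧
  `Prop22i` ∧ `Lemma23 c'` ⇒ `Theorem1` (`theorem1_of_siegel_dominate`): `0 ≤ discMean ≤ discMeanS ≤ (q + ε)𝔞𝔓_S`
  with `q < 0`, `𝔓_S ≥ 𝔓 > 0`. NO transfer identity, NO sup/avg hypothesis — the referee's currency objection does
  not touch this composition; what it costs instead is displayed: nonneg weights at COMPOSITE moduli and a main term
  for the MAJORANT family, which is `≥` the prime family's (domination makes K3 no easier).
* Part 5 (PROVED; the critic's certificate F-len-11, ls-knife-crit-1 g2 2026-08-27T00:10Z, typed verbatim). The DIRECT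
  S-family endgame: `SiegelWeightsNonneg` makes `discMeanS ≥ 0` termwise (`discMeanS_nonneg_of_weights`), so
  `theorem1_of_siegel_direct : SiegelWeightsNonneg c' → IsSmoothCutoff ψc → SiegelEStarLenPlusShape c' ψc θ X 𝒱 →
  ClosesByPositivityIn θ X 𝒱 → Theorem1` — Part 4's conclusion from a STRICT SUBSET of its hypotheses (no prime
  family, no domination, no `Prop22i`/`Lemma23`). VERDICT OF RECORD carried by this file: the majorant (Parts 1–2, 4)
  is VESTIGIAL — documentation of a step, not a rung; the residual object is E-076's composite-family row.

Typer: ls-knife-typer-1 (cell landau-siegel §D). Pinned scales (`P = exp 𝓛⁹`).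

## References
* Y. Zhang, arXiv:2211.02515v1 (2022), §2 p.4–6, (2.9), (2.15)–(2.17), Lemma 2.3, Prop. 2.2 (i); §7 Prop 7.1 (7.2);
  §8 (8.3). [cite: Zhang2022LandauSiegel, §2, §7, §8]
* T. Tao, J. Teräväinen, arXiv:2109.06291, §5 (the Siegel model; `Λ_Siegel ≥ 0`, `= Λ` on primes `> R`).
  [cite: TaoTeravainen2021, §5]
-/

noncomputable section

open Finset Real Complex ComplexConjugate

namespace Literature.NumberTheory.LFunctions.Zhang2022.KnifeEdge

open Skeleton Repair
open Literature.Barriers.Parity.TaoTeravainen (IsSmoothCutoff vonMangoldtSiegel_prime)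

variable {D : ℕ}

/-! ### Part 1 — the Siegel MAJORANT of the family index (proved, unconditional) -/

section Dominate

/-- **The critic's rung of record (shape): the Siegel weight DOMINATES the prime weight on the window** — for every
smooth cutoff, eventually in `D`, for every `G ≥ 0` on the window,
`Σ_{p ∈ primeWindow} (log p)·G(p) ≤ Σ_{m ∈ moduliWindow} Λ_Siegel(m)·G(m)`. K1's quantifier shape WITHOUT (A) and
WITHOUT an error term; PROVED below (`SiegelModuliDominate_holds`). [cite: TaoTeravainen2021, §5; Zhang2022LandauSiegel, §2 p.4] -/
def SiegelModuliDominate : Prop :=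
  ∀ ψc : ℝ → ℝ, IsSmoothCutoff ψc →
    ForAllLarge fun D _ χ => ∀ G : ℕ → ℝ, (∀ m ∈ moduliWindow D, 0 ≤ G m) →
      ∑ p ∈ primeWindow D, Real.log p * G p ≤ ∑ m ∈ moduliWindow D, siegelModulusWeight χ ψc m * G m

/-- A modulus of the window exceeds `P`. [cite: Zhang2022LandauSiegel, §2 p.4] -/
theorem bigP_lt_of_mem_moduliWindow {m : ℕ} (hm : m ∈ moduliWindow D) : bigP D < m :=
  (Nat.floor_lt (Real.exp_pos _).le).mp (Finset.mem_Ioo.mp hm).1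

/-- **Domination at one modulus `D` (proved):** for quadratic `χ`, a smooth cutoff, `1 < R ≤ P` and `G ≥ 0` on the
window, `Σ_{p∼P} (log p)G(p) ≤ Σ_{m∈W} Λ_Siegel(m)G(m)` — the prime terms agree (`Λ_Siegel(p) = log p`,
`vonMangoldtSiegel_prime`) and the composite terms are `≥ 0` (`siegelModulusWeight_nonneg`).
[cite: TaoTeravainen2021, §5 (proof of Lemma 5.1); Zhang2022LandauSiegel, §2 p.4] -/
theorem sum_primeWindow_log_le_sum_siegel {χ : DirichletCharacter ℂ D} (hχ : χ.IsQuadratic) {ψc : ℝ → ℝ}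
    (hψ : IsSmoothCutoff ψc) (hR : 1 < siegelLevel D) (hRP : siegelLevel D ≤ bigP D) {G : ℕ → ℝ}
    (hG : ∀ m ∈ moduliWindow D, 0 ≤ G m) :
    ∑ p ∈ primeWindow D, Real.log p * G p ≤ ∑ m ∈ moduliWindow D, siegelModulusWeight χ ψc m * G m := by
  rw [primeWindow_eq_filter]
  calc ∑ p ∈ (moduliWindow D).filter Nat.Prime, Real.log p * G p
      = ∑ p ∈ (moduliWindow D).filter Nat.Prime, siegelModulusWeight χ ψc p * G p := by
        refine Finset.sum_congr rfl fun p hp => ?_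
        obtain ⟨hpW, hprime⟩ := Finset.mem_filter.mp hp
        have hRp : siegelLevel D ≤ p := hRP.trans (bigP_lt_of_mem_moduliWindow hpW).le
        unfold siegelModulusWeight
        rw [vonMangoldtSiegel_prime χ hψ hR hprime hRp]
    _ ≤ ∑ m ∈ moduliWindow D, siegelModulusWeight χ ψc m * G m :=
        Finset.sum_le_sum_of_subset_of_nonneg (Finset.filter_subset _ _) fun m hm _ =>
          mul_nonneg (siegelModulusWeight_nonneg hχ ψc m) (hG m hm)

/-- **Domination in density form (proved):** `Σ_{p∼P} G(p) ≤ Σ_{m∈W} w(m)·G(m)`, `w = Λ_Siegel/log` (`= 1` on the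
primes of the window, `≥ 0` elsewhere). [cite: TaoTeravainen2021, §5; Zhang2022LandauSiegel, §2 p.4] -/
theorem sum_primeWindow_le_sum_density {χ : DirichletCharacter ℂ D} (hχ : χ.IsQuadratic) {ψc : ℝ → ℝ}
    (hψ : IsSmoothCutoff ψc) (hR : 1 < siegelLevel D) (hRP : siegelLevel D ≤ bigP D) {G : ℕ → ℝ}
    (hG : ∀ m ∈ moduliWindow D, 0 ≤ G m) :
    ∑ p ∈ primeWindow D, G p ≤ ∑ m ∈ moduliWindow D, siegelDensity χ ψc m * G m := by
  rw [primeWindow_eq_filter]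
  calc ∑ p ∈ (moduliWindow D).filter Nat.Prime, G p
      = ∑ p ∈ (moduliWindow D).filter Nat.Prime, siegelDensity χ ψc p * G p := by
        refine Finset.sum_congr rfl fun p hp => ?_
        obtain ⟨hpW, hprime⟩ := Finset.mem_filter.mp hp
        have hRp : siegelLevel D ≤ p := hRP.trans (bigP_lt_of_mem_moduliWindow hpW).le
        rw [siegelDensity_prime χ hψ hR hprime hRp, one_mul]
    _ ≤ ∑ m ∈ moduliWindow D, siegelDensity χ ψc m * G m :=
        Finset.sum_le_sum_of_subset_of_nonneg (Finset.filter_subset _ _) fun m hm _ =>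
          mul_nonneg (siegelDensity_nonneg χ ψc hχ m) (hG m hm)

/-- **`𝔓 ≤ 𝔓_S` (proved):** the Siegel family's normaliser dominates Zhang's. [cite: Zhang2022LandauSiegel, §2 (2.9)] -/
theorem frakP_le_frakPS {χ : DirichletCharacter ℂ D} (hχ : χ.IsQuadratic) {ψc : ℝ → ℝ} (hψ : IsSmoothCutoff ψc)
    (hR : 1 < siegelLevel D) (hRP : siegelLevel D ≤ bigP D) : frakP D ≤ frakPS D χ ψc := by
  rw [frakP_eq_sum_primeWindow]
  exact sum_primeWindow_le_sum_density hχ hψ hR hRP fun m _ => Nat.cast_nonneg m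

/-- Eventually every fixed real is below `𝓛 = log D` (private copy of the standing-quantifier bookkeeping; the tree's
public one is `Phi3Eval.forAllLarge_le_ell`). [cite: Zhang2022LandauSiegel, §2 p.4] -/
private theorem forAllLarge_le_ell (X : ℝ) : ForAllLarge fun D _ _ => X ≤ ell D := by
  refine ForAllLarge.of_le (⌈Real.exp X⌉₊ + 1) fun D _ χ hD _ _ => ?_
  have hDexp : Real.exp X ≤ D := (Nat.le_ceil _).trans (by exact_mod_cast (by omega : ⌈Real.exp X⌉₊ ≤ D))
  rw [← Real.log_exp X]
  exact Real.log_le_log (Real.exp_pos _) hDexp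

/-- Eventually `1 < R = exp 𝓛⁸ ≤ P = exp 𝓛⁹` (`𝓛 ≥ 1`). [cite: Zhang2022LandauSiegel, §2 (2.6); TaoTeravainen2021, §2.4 (2.3)] -/
theorem forAllLarge_siegelLevel : ForAllLarge fun D _ _ => 1 < siegelLevel D ∧ siegelLevel D ≤ bigP D := by
  refine (forAllLarge_le_ell 1).mono fun D _ χ _ _ hℓ => ?_
  have hℓ0 : 0 < ell D := by linarith
  refine ⟨Real.one_lt_exp_iff.mpr (by positivity), Real.exp_le_exp.mpr ?_⟩
  exact pow_le_pow_right₀ hℓ (by norm_num)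

/-- **THE MAJORANT, PROVED** (unconditional: no (A), no error term). [cite: TaoTeravainen2021, §5; Zhang2022LandauSiegel, §2 p.4] -/
theorem SiegelModuliDominate_holds : SiegelModuliDominate := by
  intro ψc hψ
  refine forAllLarge_siegelLevel.mono fun D _ χ hq _ hR G hG => ?_
  exact sum_primeWindow_log_le_sum_siegel hq hψ hR.1 hR.2 hG

end Dominate

/-! ### Part 2 — domination of discrete means (proved), given nonnegative weights on the Siegel family -/

section MeanDominate

variable (c' : ℝ)

/-- **NONNEGATIVE WEIGHTS ON THE SIEGEL FAMILY (shape, NOT asserted):** under (A), eventually in `D`, at every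
member `ψ (mod m)`, `m` ANY modulus of the window, of the Siegel family's `Ψ₁` and every sampled zero `ρ`,
`Re 𝔠*(ρ,ψ)·Re ω(ρ) ≥ 0` — i.e. the manuscript's Lemma 2.3 (`𝔠* ≥ 0`) and Prop. 2.2 (i) (zeros on the line ⇒ `ω > 0`)
read at COMPOSITE moduli too (the manuscript states them for `ψ ∈ Ψ`, prime moduli: `Skeleton.Lemma23`, `Prop22i`,
whence `weights_nonneg_of` on the prime fibre). This is what the one-sided transfer costs in place of K1. OPEN.
[cite: Zhang2022LandauSiegel, §2 Lemma 2.3, Prop. 2.2 (i), (2.15)] -/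
def SiegelWeightsNonneg : Prop :=
  ForAllLarge fun D _ χ => AssumptionA D χ →
    ∀ y ∈ PsiOneS χ, ∀ ρ ∈ zeroSetS D y, 0 ≤ (cstarS c' D y ρ).re * (omegaW D ρ).re

variable {c'}

/-- With nonnegative weights every per-modulus mean slice is `≥ 0`. [cite: Zhang2022LandauSiegel, §2 Lemma 2.3, (2.15)] -/
theorem modMean_nonneg {χ : DirichletCharacter ℂ D}
    (hw : ∀ y ∈ PsiOneS χ, ∀ ρ ∈ zeroSetS D y, 0 ≤ (cstarS c' D y ρ).re * (omegaW D ρ).re)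
    (U : SChr D → ℂ → ℂ) (k : ℕ) : 0 ≤ modMean c' χ U k := by
  refine Finset.sum_nonneg fun y hy => Finset.sum_nonneg fun ρ hρ => ?_
  have h := mul_nonneg (hw y ((mem_famAt χ).mp hy).2 ρ (mem_of_mem_finsetOf hρ)) (sq_nonneg ‖U y ρ‖)
  nlinarith

/-- **DOMINATION OF DISCRETE MEANS (proved):** for quadratic `χ`, a smooth cutoff, `1 < R ≤ P` and nonnegative
weights on the Siegel family, Zhang's discrete mean of ANY table restricted along `toS` is at most the Siegel
family's: `discMean (U∘toS) ≤ discMeanS U` — exact (no error term, no transfer identity, no sup/avg hypothesis).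
[cite: Zhang2022LandauSiegel, §2 (2.16), §8 (8.3); TaoTeravainen2021, §5] -/
theorem discMean_le_discMeanS {χ : DirichletCharacter ℂ D} (hχ : χ.IsQuadratic) {ψc : ℝ → ℝ}
    (hψ : IsSmoothCutoff ψc) (hR : 1 < siegelLevel D) (hRP : siegelLevel D ≤ bigP D)
    (hw : ∀ y ∈ PsiOneS χ, ∀ ρ ∈ zeroSetS D y, 0 ≤ (cstarS c' D y ρ).re * (omegaW D ρ).re)
    (U : SChr D → ℂ → ℂ) : discMean c' χ (fun x => U (toS x)) ≤ discMeanS c' χ ψc U := by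
  rw [discMean_eq_sum_modMean]
  exact sum_primeWindow_le_sum_density hχ hψ hR hRP fun m _ => modMean_nonneg hw U m

end MeanDominate

/-! ### Part 3 — the UPPER shape and its positivity endgame (proved: the endgame uses only the upper half) -/

section UpperEndgame

/-- **THE POSITIVITY ENDGAME, UPPER FORM, GENERAL NORMALISER (proved).** If under (A) the discrete mean of SOME
tables has an UPPER asymptotic `discMean ≤ (m + ε)·𝔞·N` for every `ε > 0`, with `m < 0` and an eventually positive
normaliser `N`, then — given Prop. 2.2 (i) and Lemma 2.3, which make every discrete mean `≥ 0`
(`weights_nonneg_of`, `discMean_nonneg`), and `𝔞 ≥ a₀ > 0` under (A) (`frakALowerBound_holds`) — (A) fails for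
every real primitive character to every large modulus. The lower half of the asymptotic is never used.
[cite: Zhang2022LandauSiegel, §2 p.6, Lemma 2.3, Prop. 2.2 (i), (2.15)] -/
theorem eventually_not_assumptionA_of_upper_mainTerm {c' m : ℝ} (hm : m < 0)
    {N : (D : ℕ) → DirichletCharacter ℂ D → ℝ} (hN : ForAllLarge fun D _ χ => AssumptionA D χ → 0 < N D χ)
    {F : (D : ℕ) → (χ : DirichletCharacter ℂ D) → Chr D → ℂ → ℂ}
    (hasymp : ∀ ε : ℝ, 0 < ε → ForAllLarge fun D _ χ => AssumptionA D χ →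
      discMean c' χ (F D χ) - m * frakA χ * N D χ ≤ ε * frakA χ * N D χ)
    (h22 : Prop22i) (h23 : Lemma23 c') :
    ∃ D₀ : ℕ, ∀ (D : ℕ) [NeZero D] (χ : DirichletCharacter ℂ D),
      D₀ ≤ D → χ.IsQuadratic → χ.IsPrimitive → ¬ AssumptionA D χ := by
  have hε : 0 < -m / 2 := by linarith
  obtain ⟨a₀, ha₀, hA⟩ := frakALowerBound_holds
  obtain ⟨D₁, h₁⟩ := ((((hasymp (-m / 2) hε).and h22).and h23).and hN).and hA
  refine ⟨max D₁ 3, fun D _ χ hD hq hp hAss => ?_⟩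
  have hD₁ : D₁ ≤ D := le_trans (le_max_left _ _) hD
  have hD3 : 3 ≤ D := le_trans (le_max_right _ _) hD
  obtain ⟨⟨⟨⟨hmean, h22'⟩, h23'⟩, hN'⟩, hA'⟩ := h₁ D χ hD₁ hq hp
  have hmean' := hmean hAss
  have hA0 : 0 < frakA χ := lt_of_lt_of_le ha₀ (hA' hAss)
  have hN0 : 0 < N D χ := hN' hAss
  have hw := weights_nonneg_of hD3 h23' h22'
  have hpos := discMean_nonneg hw (F D χ)
  have hX : 0 < frakA χ * N D χ := mul_pos hA0 hN0
  nlinarith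

variable (c' : ℝ)

/-- **E*-len⁺ UPPER SHAPE (row E-002 with `|·|` dropped, `≤` kept; shape, NOT asserted):** under (A), eventually, the
discrete mean of the two-piece design `s·u ⊕ v` (`u` in class, `v ∈ 𝒱`) is AT MOST `(q_X(s) + ε)·𝔞𝔓`,
`q_X = twoPieceMainTerm θ X`. The half the positivity endgame consumes (`theorem1_of_eStarLenPlusUpperShape`).
[cite: Zhang2022LandauSiegel, §7 Prop 7.1 (7.2), §8 (8.3)] -/
def EStarLenPlusUpperShape (θ : ℝ) (X : PairFunctional) (𝒱 : (ℝ → ℂ) → (ℝ → ℂ) → Prop) : Prop :=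
  ∀ (u u' v v' : ℝ → ℂ) (s : ℂ), InClassPiece u u' → 𝒱 v v' →
    ∀ ε : ℝ, 0 < ε → ForAllLarge fun D _ χ => AssumptionA D χ →
      discMean c' χ (fun x t => profPoly χ x (fun z => s * u z + v z) ⌈bigP D ^ θ⌉₊ t)
          - twoPieceMainTerm θ X u u' v v' s * frakA χ * frakP D ≤ ε * frakA χ * frakP D

variable {c'} {θ : ℝ} {X : PairFunctional} {𝒱 : (ℝ → ℂ) → (ℝ → ℂ) → Prop}

/-- The two-sided row E-002 gives the upper shape. [cite: Zhang2022LandauSiegel, §7 Prop 7.1 (7.2)] -/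
theorem EStarLenPlusShape.upper (h : EStarLenPlusShape c' θ X 𝒱) : EStarLenPlusUpperShape c' θ X 𝒱 :=
  fun u u' v v' s hu hv ε hε => (h u u' v v' s hu hv ε hε).mono fun _ _ _ _ _ h1 hA => (abs_le.mp (h1 hA)).2

/-- `𝔓 > 0` eventually, in `ForAllLarge` form. [cite: Zhang2022LandauSiegel, §2 (2.9)] -/
theorem forAllLarge_frakP_pos : ForAllLarge fun D _ _ => 0 < frakP D := by
  obtain ⟨D₀, h⟩ := frakP_eventually_pos
  exact ForAllLarge.of_le D₀ fun D _ _ hD _ _ => h D hD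

/-- **THE UPPER-SHAPE ENDGAME (proved): `EStarLenPlusUpperShape` + a closing design + Prop. 2.2 (i) + Lemma 2.3 ⇒
Theorem 1** — the same conclusion as `theorem1_of_eStarLenPlusShape` from the upper half alone (the critic's check:
the endgame never uses the lower half). Hypotheses OPEN / CLAIMS; nothing asserted.
[cite: Zhang2022LandauSiegel, §2 p.6, §7 Prop 7.1 (7.2)] -/
theorem theorem1_of_eStarLenPlusUpperShape (hE : EStarLenPlusUpperShape c' θ X 𝒱) (hC : ClosesByPositivityIn θ X 𝒱)
    (h22 : Prop22i) (h23 : Lemma23 c') : Theorem1 := by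
  obtain ⟨u, u', v, v', s, hu, hv, hneg⟩ := hC
  exact Skeleton.theorem1_of_eventually_not_assumptionA
    (eventually_not_assumptionA_of_upper_mainTerm (N := fun D _ => frakP D)
      (F := fun D χ x t => profPoly χ x (fun z => s * u z + v z) ⌈bigP D ^ θ⌉₊ t) hneg
      (forAllLarge_frakP_pos.mono fun _ _ _ _ _ h _ => h) (hE u u' v v' s hu hv) h22 h23)

/-- … and Theorem 2. [cite: Zhang2022LandauSiegel, §1 Theorem 2] -/
theorem theorem2_of_eStarLenPlusUpperShape (hE : EStarLenPlusUpperShape c' θ X 𝒱) (hC : ClosesByPositivityIn θ X 𝒱)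
    (h22 : Prop22i) (h23 : Lemma23 c') : Theorem2 :=
  Skeleton.theorem2_of_theorem1 (theorem1_of_eStarLenPlusUpperShape hE hC h22 h23)

end UpperEndgame

/-! ### Part 4 — the ONE-SIDED TRANSFER: Siegel-family asymptotic ∧ nonneg weights ⇒ the endgame (no K1, no sup hypothesis) -/

section OneSided

variable (c' : ℝ) (ψc : ℝ → ℝ)

/-- **THE SIEGEL FAMILY'S WHOLE-DESIGN ROW (shape, NOT asserted — the object the card's K2 «CIS divisor switching for
the linearised family» is to evaluate):** under (A), eventually in `D`, the Siegel family's discrete mean (every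
modulus of the window, density `Λ_Siegel/log`, cutoff `ψc`) of the two-piece design `s·u ⊕ v` is
`q_X(s)·𝔞·𝔓_S + o(𝔞𝔓_S)` — two-sided, on the COMPOSITE family (composes from the three Siegel slots of
`KnifeEdgeLenSiegelSlots` by the Siegel-side slot algebra, not typed here). [cite: Zhang2022LandauSiegel, §7 Prop 7.1 (7.2), §8 (8.3); TaoTeravainen2021, §5] -/
def SiegelEStarLenPlusShape (θ : ℝ) (X : PairFunctional) (𝒱 : (ℝ → ℂ) → (ℝ → ℂ) → Prop) : Prop :=
  ∀ (u u' v v' : ℝ → ℂ) (s : ℂ), InClassPiece u u' → 𝒱 v v' →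
    ∀ ε : ℝ, 0 < ε → ForAllLarge fun D _ χ => AssumptionA D χ →
      |discMeanS c' χ ψc (fun y t => profPolyS χ y (fun z => s * u z + v z) ⌈bigP D ^ θ⌉₊ t)
          - twoPieceMainTerm θ X u u' v v' s * frakA χ * frakPS D χ ψc| ≤ ε * frakA χ * frakPS D χ ψc

variable {c' ψc} {θ : ℝ} {X : PairFunctional} {𝒱 : (ℝ → ℂ) → (ℝ → ℂ) → Prop}

/-- **One-sided transfer of the row (proved):** nonneg weights on the Siegel family and the Siegel whole-design row
give, for every design and `ε > 0`, eventually under (A), the UPPER asymptotic of Zhang's prime-family mean against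
the Siegel normaliser: `discMean(prime) ≤ (q_X(s) + ε)·𝔞·𝔓_S` (`discMean_le_discMeanS`). [cite: Zhang2022LandauSiegel, §7 (7.2), §8 (8.3); TaoTeravainen2021, §5] -/
theorem upper_of_siegel_dominate (hW : SiegelWeightsNonneg c') (hψ : IsSmoothCutoff ψc)
    (hE : SiegelEStarLenPlusShape c' ψc θ X 𝒱) {u u' v v' : ℝ → ℂ} {s : ℂ} (hu : InClassPiece u u') (hv : 𝒱 v v')
    {ε : ℝ} (hε : 0 < ε) :
    ForAllLarge fun D _ χ => AssumptionA D χ →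
      discMean c' χ (fun x t => profPoly χ x (fun z => s * u z + v z) ⌈bigP D ^ θ⌉₊ t)
          - twoPieceMainTerm θ X u u' v v' s * frakA χ * frakPS D χ ψc ≤ ε * frakA χ * frakPS D χ ψc := by
  refine (((hE u u' v v' s hu hv ε hε).and hW).and forAllLarge_siegelLevel).mono fun D _ χ hq _ hh hA => ?_
  obtain ⟨⟨h1, h2⟩, hR⟩ := hh
  have hup := (abs_le.mp (h1 hA)).2
  have hdom := discMean_le_discMeanS hq hψ hR.1 hR.2 (h2 hA)
    (fun y t => profPolyS χ y (fun z => s * u z + v z) ⌈bigP D ^ θ⌉₊ t)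
  have hdef : discMean c' χ (fun x t => profPoly χ x (fun z => s * u z + v z) ⌈bigP D ^ θ⌉₊ t)
      = discMean c' χ (fun x => (fun y t => profPolyS χ y (fun z => s * u z + v z) ⌈bigP D ^ θ⌉₊ t) (toS x)) := rfl
  rw [hdef]
  linarith

/-- **THE ONE-SIDED LINE AS A KERNEL IMPLICATION (proved): Siegel whole-design row ∧ nonneg weights on the Siegel
family ∧ a closing design ∧ Prop. 2.2 (i) ∧ Lemma 2.3 ⇒ Theorem 1.** `0 ≤ discMean(prime) ≤ discMeanS ≤
(q + ε)𝔞𝔓_S`, `q < 0`, `𝔓_S ≥ 𝔓 > 0` (`frakP_le_frakPS`), `𝔞 > 0` — NO transfer identity K1 and NO sup/avg hypothesis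
enter (the referee's currency objection is about those); the price is displayed instead: `SiegelWeightsNonneg`
(Lemma 2.3/Prop 2.2 (i) at composite moduli) and a main term for the MAJORANT family (`≥` the prime family's, so
closing is no easier). Every hypothesis OPEN / a CLAIM; nothing asserted. [cite: Zhang2022LandauSiegel, §2 p.6, §7 Prop 7.1 (7.2); TaoTeravainen2021, §5] -/
theorem theorem1_of_siegel_dominate (hW : SiegelWeightsNonneg c') (hψ : IsSmoothCutoff ψc)
    (hE : SiegelEStarLenPlusShape c' ψc θ X 𝒱) (hC : ClosesByPositivityIn θ X 𝒱) (h22 : Prop22i)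
    (h23 : Lemma23 c') : Theorem1 := by
  obtain ⟨u, u', v, v', s, hu, hv, hneg⟩ := hC
  refine Skeleton.theorem1_of_eventually_not_assumptionA
    (eventually_not_assumptionA_of_upper_mainTerm (N := fun D χ => frakPS D χ ψc)
      (F := fun D χ x t => profPoly χ x (fun z => s * u z + v z) ⌈bigP D ^ θ⌉₊ t) hneg ?_
      (fun ε hε => upper_of_siegel_dominate hW hψ hE hu hv hε) h22 h23)
  refine (forAllLarge_frakP_pos.and forAllLarge_siegelLevel).mono fun D _ χ hq _ hh _ => ?_
  exact lt_of_lt_of_le hh.1 (frakP_le_frakPS hq hψ hh.2.1 hh.2.2)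

/-- … and Theorem 2. [cite: Zhang2022LandauSiegel, §1 Theorem 2] -/
theorem theorem2_of_siegel_dominate (hW : SiegelWeightsNonneg c') (hψ : IsSmoothCutoff ψc)
    (hE : SiegelEStarLenPlusShape c' ψc θ X 𝒱) (hC : ClosesByPositivityIn θ X 𝒱) (h22 : Prop22i)
    (h23 : Lemma23 c') : Theorem2 :=
  Skeleton.theorem2_of_theorem1 (theorem1_of_siegel_dominate hW hψ hE hC h22 h23)

end OneSided

/-! ### Part 5 — the critic's certificate F-len-11 (ls-knife-crit-1 g2, `VestigialMajorant.lean`): the DIRECT S-family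
endgame. `SiegelWeightsNonneg` already makes `discMeanS ≥ 0` TERMWISE, so the Siegel row (upper half) and a closing
design refute (A) with NO prime family, NO domination, NO `Prop22i`/`Lemma23`: hypotheses(direct) ⊊ hypotheses(Part 4)
— the majorant step of Parts 1–2/4 is vestigial (documentation, not a rung). -/

section Direct

variable {c' : ℝ} {ψc : ℝ → ℝ} {θ : ℝ} {X : PairFunctional} {𝒱 : (ℝ → ℂ) → (ℝ → ℂ) → Prop}

/-- The Siegel family's discrete mean is `≥ 0` as soon as its weights are (`siegelDensity ≥ 0`, `modMean ≥ 0`,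
termwise in `discMeanS = Σ_m w(m)·modMean(m)`) — no prime family needed. [cite: Zhang2022LandauSiegel, §2 Lemma 2.3, Prop. 2.2 (i); TaoTeravainen2021, §5] -/
theorem discMeanS_nonneg_of_weights {χ : DirichletCharacter ℂ D} (hχ : χ.IsQuadratic)
    (hw : ∀ y ∈ PsiOneS χ, ∀ ρ ∈ zeroSetS D y, 0 ≤ (cstarS c' D y ρ).re * (omegaW D ρ).re)
    (U : SChr D → ℂ → ℂ) : 0 ≤ discMeanS c' χ ψc U :=
  Finset.sum_nonneg fun k _ =>
    mul_nonneg (siegelDensity_nonneg (ψc := ψc) (hχ := hχ) (m := k)) (modMean_nonneg hw U k)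

/-- **Direct S-family endgame (proved; critic's certificate F-len-11):** Siegel row (upper half only) ∧ nonneg Siegel
weights ∧ a closing design ⇒ ¬(A) eventually — WITHOUT `Prop22i`, `Lemma23`, the prime family or any domination.
[cite: Zhang2022LandauSiegel, §2 p.6, §7 Prop 7.1 (7.2); TaoTeravainen2021, §5] -/
theorem eventually_not_assumptionA_of_siegel_direct (hW : SiegelWeightsNonneg c') (hψ : IsSmoothCutoff ψc)
    (hE : SiegelEStarLenPlusShape c' ψc θ X 𝒱) (hC : ClosesByPositivityIn θ X 𝒱) :
    ∃ D₀ : ℕ, ∀ (D : ℕ) [NeZero D] (χ : DirichletCharacter ℂ D),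
      D₀ ≤ D → χ.IsQuadratic → χ.IsPrimitive → ¬ AssumptionA D χ := by
  obtain ⟨u, u', v, v', s, hu, hv, hneg⟩ := hC
  have hε : 0 < -(twoPieceMainTerm θ X u u' v v' s) / 2 := by linarith
  obtain ⟨a₀, ha₀, hA⟩ := frakALowerBound_holds
  obtain ⟨D₁, h₁⟩ :=
    ((((hE u u' v v' s hu hv _ hε).and hW).and forAllLarge_siegelLevel).and forAllLarge_frakP_pos).and hA
  refine ⟨D₁, fun D _ χ hD hq hp hAss => ?_⟩
  obtain ⟨⟨⟨⟨hmean, hW'⟩, hR⟩, hP⟩, hA'⟩ := h₁ D χ hD hq hp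
  have hup := (abs_le.mp (hmean hAss)).2
  have hA0 : 0 < frakA χ := lt_of_lt_of_le ha₀ (hA' hAss)
  have hPS : 0 < frakPS D χ ψc := lt_of_lt_of_le hP (frakP_le_frakPS hq hψ hR.1 hR.2)
  have hpos : 0 ≤ discMeanS c' χ ψc
      (fun y t => profPolyS χ y (fun z => s * u z + v z) ⌈bigP D ^ θ⌉₊ t) :=
    discMeanS_nonneg_of_weights hq (hW' hAss) _
  have hX : 0 < frakA χ * frakPS D χ ψc := mul_pos hA0 hPS
  nlinarith

/-- **Theorem 1 from the S-family ALONE** (`SiegelWeightsNonneg ∧ IsSmoothCutoff ψc ∧ SiegelEStarLenPlusShape ∧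
ClosesByPositivityIn ⇒ Theorem1`) — a STRICT SUBSET of the hypotheses of `theorem1_of_siegel_dominate` (Part 4), which
additionally assumes `Prop22i`, `Lemma23 c'` and routes through Zhang's prime family: the majorant is vestigial. What is
left to evaluate is E-076's composite `Λ_S/log`-weighted family row. [cite: Zhang2022LandauSiegel, §1 Theorem 1, §2 p.6; TaoTeravainen2021, §5] -/
theorem theorem1_of_siegel_direct (hW : SiegelWeightsNonneg c') (hψ : IsSmoothCutoff ψc)
    (hE : SiegelEStarLenPlusShape c' ψc θ X 𝒱) (hC : ClosesByPositivityIn θ X 𝒱) : Theorem1 :=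
  Skeleton.theorem1_of_eventually_not_assumptionA (eventually_not_assumptionA_of_siegel_direct hW hψ hE hC)

/-- … and Theorem 2. [cite: Zhang2022LandauSiegel, §1 Theorem 2] -/
theorem theorem2_of_siegel_direct (hW : SiegelWeightsNonneg c') (hψ : IsSmoothCutoff ψc)
    (hE : SiegelEStarLenPlusShape c' ψc θ X 𝒱) (hC : ClosesByPositivityIn θ X 𝒱) : Theorem2 :=
  Skeleton.theorem2_of_theorem1 (theorem1_of_siegel_direct hW hψ hE hC)

/-- Part 4's majorant route is Part 5's direct route weakened by two idle hypotheses. [cite: Zhang2022LandauSiegel, §1 Theorem 1] -/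
theorem theorem1_of_siegel_dominate' (hW : SiegelWeightsNonneg c') (hψ : IsSmoothCutoff ψc)
    (hE : SiegelEStarLenPlusShape c' ψc θ X 𝒱) (hC : ClosesByPositivityIn θ X 𝒱) (_h22 : Prop22i)
    (_h23 : Lemma23 c') : Theorem1 :=
  theorem1_of_siegel_direct hW hψ hE hC

end Direct

end Literature.NumberTheory.LFunctions.Zhang2022.KnifeEdge

end
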